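import Literature.Analysis.SpecialFunctions.HypergeometricPfaff
import Literature.Combinatorics.Enumerative.PfaffSaalschutz
import HarnessLib

/-!
# Euler's transformation `₂F₁(a,b;c;z) = (1−z)^{c−a−b} ₂F₁(c−a,c−b;c;z)`: the series on the
# disc and Euler's integral on the half-plane `Re z < 1`; Pfaff's second form

Continuation of `HypergeometricPfaff.lean`. **Euler's transformation** (DLMF 15.8.1, third form)
is proved FIRST for Mathlib's series on the whole unit disc and for ALL parameters with
`c ∉ −ℕ` (`ordinaryHypergeometric_euler`): the coefficient of `zⁿ` in the Cauchy product
`(1−z)^{−(c−a−b)} · ₂F₁(a,b;c;z) = Σₘ (c−a−b)ₘ/m! zᵐ · Σₖ αₖ(a,b,c) zᵏ` is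
`Σₖ αₖ(a,b,c)(c−a−b)ₙ₋ₖ/(n−k)! = αₙ(c−a,c−b,c)` — this is exactly the tree's **Pfaff–Saalschütz
summation** `Literature.Combinatorics.Enumerative.pfaffSaalschutz_ascPochhammer` divided by
`n!(c)ₙ` (`sum_coeff_mul_binomialCoeff`). Then:

* `eulerHypergeometric_euler` — Euler's transformation for Euler's integral `E(a,b;c;z)` on the
  half-plane `Re z < 1`, `0 < Re b < Re c` (both sides are analytic on the convex half-plane and
  agree on the disc by DLMF 15.6.1; identity theorem), and the throat form
  `E(a,b;c;−x) = (1+x)^{c−a−b} E(c−a,c−b;c;−x)`, `x > −1`;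
* `eulerHypergeometric_pfaff'` — **Pfaff's second form** `E(a,b;c;z) = (1−z)^{−b} E(c−a,b;c;z/(z−1))`
  (Euler ∘ Pfaff), and `ordinaryHypergeometric_pfaff'` for the series on the lens
  `‖z‖ < 1, Re z < ½`;
* `eulerHypergeometric_symm` — the symmetry `E(a,b;c;z) = E(b,a;c;z)` on `Re z < 1` when BOTH
  Euler integrals converge (`0 < Re a, Re b < Re c`; same identity-theorem argument).

References: NIST DLMF (15.8.1) [DLMF]; Andrews–Askey–Roy, *Special Functions* (1999), Thm 2.2.5,
(2.2.7), Thm 2.2.6 [AndrewsAskeyRoy1999].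
-/

noncomputable section

open Filter Metric Set Finset
open scoped Topology Nat

namespace Literature.Analysis.SpecialFunctions.Hypergeometric

/-! ### The coefficient identity (Pfaff–Saalschütz divided by `n!(c)ₙ`) -/

/-- `(c)ₙ = (c)ₖ (c+k)ₙ₋ₖ` for `k ≤ n`. [cite: DLMF, 5.2.5] -/
theorem ascPochhammer_eval_split (c : ℂ) {k n : ℕ} (hk : k ≤ n) :
    (ascPochhammer ℂ n).eval c =
      (ascPochhammer ℂ k).eval c * (ascPochhammer ℂ (n - k)).eval (c + k) := by
  have h := congrArg (Polynomial.eval c) (ascPochhammer_mul ℂ k (n - k))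
  rw [Nat.add_sub_cancel' hk] at h
  rw [← h, Polynomial.eval_mul, Polynomial.eval_comp, Polynomial.eval_add, Polynomial.eval_X,
    Polynomial.eval_natCast]

/-- `(c)ₖ ≠ 0` for all `k` when `c ∉ −ℕ`. [folklore] -/
theorem ascPochhammer_eval_ne_zero_of_ne_neg_nat {c : ℂ} (hc : ∀ n : ℕ, c ≠ -n) (k : ℕ) :
    (ascPochhammer ℂ k).eval c ≠ 0 := fun h => by
  obtain ⟨j, -, hj⟩ := (ascPochhammer_eval_eq_zero_iff k c).1 h
  exact hc j (by rw [hj, neg_neg])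

/-- **The coefficient identity behind Euler's transformation** (Pfaff–Saalschütz divided by
`n!(c)ₙ`): with `αₙ(a,b,c) = (a)ₙ(b)ₙ/((c)ₙ n!)` (Mathlib's `ordinaryHypergeometricCoefficient`)
and `c ∉ −ℕ`, `Σₖ₌₀ⁿ αₖ(a,b,c) · (c−a−b)ₙ₋ₖ/(n−k)! = αₙ(c−a, c−b, c)`.
[cite: AndrewsAskeyRoy1999, Thm. 2.2.6] -/
theorem sum_coeff_mul_binomialCoeff {a b c : ℂ} (hc : ∀ n : ℕ, c ≠ -n) (n : ℕ) :
    ∑ k ∈ range (n + 1), ordinaryHypergeometricCoefficient a b c k *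
        ((((n - k) ! : ℕ) : ℂ)⁻¹ * (ascPochhammer ℂ (n - k)).eval (c - a - b)) =
      ordinaryHypergeometricCoefficient (c - a) (c - b) c n := by
  have hPn : (ascPochhammer ℂ n).eval c ≠ 0 := ascPochhammer_eval_ne_zero_of_ne_neg_nat hc n
  have hn : ((n ! : ℕ) : ℂ) ≠ 0 := by exact_mod_cast Nat.factorial_ne_zero n
  have hPS := Literature.Combinatorics.Enumerative.pfaffSaalschutz_ascPochhammer a b c n
  -- termwise: `n!(c)ₙ · αₖ βₙ₋ₖ` is the Pfaff–Saalschütz summand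
  have hterm : ∀ k ∈ range (n + 1), ((n ! : ℕ) : ℂ) * (ascPochhammer ℂ n).eval c *
      (ordinaryHypergeometricCoefficient a b c k *
        ((((n - k) ! : ℕ) : ℂ)⁻¹ * (ascPochhammer ℂ (n - k)).eval (c - a - b))) =
      (n.choose k : ℂ) * (ascPochhammer ℂ k).eval a * (ascPochhammer ℂ k).eval b *
        (ascPochhammer ℂ (n - k)).eval (c + k) * (ascPochhammer ℂ (n - k)).eval (c - a - b) := by
    intro k hk
    have hkn : k ≤ n := Nat.lt_succ_iff.1 (mem_range.1 hk)
    have hPk : (ascPochhammer ℂ k).eval c ≠ 0 := ascPochhammer_eval_ne_zero_of_ne_neg_nat hc k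
    have hk0 : ((k ! : ℕ) : ℂ) ≠ 0 := by exact_mod_cast Nat.factorial_ne_zero k
    have hnk0 : (((n - k) ! : ℕ) : ℂ) ≠ 0 := by exact_mod_cast Nat.factorial_ne_zero (n - k)
    have hfact : ((n ! : ℕ) : ℂ) = (n.choose k : ℂ) * ((k ! : ℕ) : ℂ) * (((n - k) ! : ℕ) : ℂ) := by
      exact_mod_cast (Nat.choose_mul_factorial_mul_factorial hkn).symm
    rw [ordinaryHypergeometricCoefficient, ascPochhammer_eval_split c hkn, hfact]
    field_simp
  rw [← mul_right_inj' (mul_ne_zero hn hPn), Finset.mul_sum, Finset.sum_congr rfl hterm, hPS,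
    ordinaryHypergeometricCoefficient]
  field_simp

/-! ### Euler's transformation for the series on the unit disc -/

/-- The terms `αₙ zⁿ` of the hypergeometric series are absolutely summable on `‖z‖ < 1`.
[cite: DLMF, 15.2.1] -/
theorem summable_norm_coeff_mul_pow' (a b c : ℂ) {z : ℂ} (hz : ‖z‖ < 1) :
    Summable fun n : ℕ => ‖ordinaryHypergeometricCoefficient a b c n * z ^ n‖ := by
  simpa only [norm_mul, norm_pow] using summable_norm_coeff_mul_pow a b c (norm_nonneg z) hz

/-- The binomial coefficients `(s)ₙ/n!` are the hypergeometric coefficients `αₙ(s,1,1)`.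
[cite: DLMF, 15.4.6] -/
theorem binomialCoeff_eq_coeff (s : ℂ) (n : ℕ) :
    ((n ! : ℕ) : ℂ)⁻¹ * (ascPochhammer ℂ n).eval s = ordinaryHypergeometricCoefficient s 1 1 n := by
  simp only [ordinaryHypergeometricCoefficient, ascPochhammer_eval_one]
  have hn : ((n ! : ℕ) : ℂ) ≠ 0 := by exact_mod_cast Nat.factorial_ne_zero n
  field_simp

/-- **Euler's transformation for Gauss's series** (DLMF 15.8.1, third form): for `c ∉ −ℕ` and
`‖z‖ < 1`, `₂F₁(a,b;c;z) = (1 − z)^{c−a−b} ₂F₁(c−a, c−b; c; z)` — Cauchy product of the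
binomial series `(1−z)^{−(c−a−b)} = Σ (c−a−b)ₘ zᵐ/m!` with `₂F₁(a,b;c;z)` and the
Pfaff–Saalschütz identity `sum_coeff_mul_binomialCoeff`. [cite: DLMF, 15.8.1] -/
theorem ordinaryHypergeometric_euler {a b c : ℂ} (hc : ∀ n : ℕ, c ≠ -n) {z : ℂ} (hz : ‖z‖ < 1) :
    ₂F₁ a b c z = (1 - z) ^ (c - a - b) * ₂F₁ (c - a) (c - b) c z := by
  set f : ℕ → ℂ := fun n => ordinaryHypergeometricCoefficient a b c n * z ^ n with hf
  set g : ℕ → ℂ := fun n => ((n ! : ℕ) : ℂ)⁻¹ * (ascPochhammer ℂ n).eval (c - a - b) * z ^ n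
    with hg
  have hf_sum : HasSum f (₂F₁ a b c z) := hasSum_coeff_mul_pow hz
  have hg_sum : HasSum g ((1 - z) ^ (-(c - a - b))) := hasSum_one_sub_cpow_neg (c - a - b) hz
  have hf_norm : Summable fun n => ‖f n‖ := summable_norm_coeff_mul_pow' a b c hz
  have hg_norm : Summable fun n => ‖g n‖ := by
    have h := summable_norm_coeff_mul_pow' (c - a - b) 1 1 hz
    refine h.congr fun n => ?_
    simp only [hg, ← binomialCoeff_eq_coeff]
  -- the Cauchy product
  have hprod := tsum_mul_tsum_eq_tsum_sum_range_of_summable_norm hf_norm hg_norm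
  rw [hf_sum.tsum_eq, hg_sum.tsum_eq] at hprod
  have hdiag : ∀ n : ℕ, ∑ k ∈ range (n + 1), f k * g (n - k) =
      ordinaryHypergeometricCoefficient (c - a) (c - b) c n * z ^ n := by
    intro n
    rw [← sum_coeff_mul_binomialCoeff hc n, Finset.sum_mul]
    refine Finset.sum_congr rfl fun k hk => ?_
    have hkn : k ≤ n := Nat.lt_succ_iff.1 (mem_range.1 hk)
    simp only [hf, hg]
    rw [show z ^ n = z ^ k * z ^ (n - k) by rw [← pow_add, Nat.add_sub_cancel' hkn]]
    ring
  simp only [hdiag] at hprod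
  rw [← eq_tsum] at hprod
  -- `₂F₁(a,b;c;z) (1−z)^{−(c−a−b)} = ₂F₁(c−a,c−b;c;z)`; divide by the nonvanishing power
  have h1z : (1 : ℂ) - z ≠ 0 := by
    intro h
    have : ‖z‖ = 1 := by rw [← sub_eq_zero.1 h]; simp
    linarith
  have hpow : (1 - z) ^ (c - a - b) ≠ 0 := Complex.cpow_ne_zero_iff.2 (Or.inl h1z)
  rw [← hprod, Complex.cpow_neg]
  field_simp

/-! ### Euler's transformation for Euler's integral on the half-plane -/

/-- `Re c > 0` excludes `c ∈ −ℕ` (inlined; the tree has it under unrelated imports). [folklore] -/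
private theorem ne_neg_nat_of_re_pos' {c : ℂ} (hc : 0 < c.re) (n : ℕ) : c ≠ -n := fun h => by
  have h' := congrArg Complex.re h
  simp at h'
  linarith [n.cast_nonneg (α := ℝ)]

/-- `w ↦ (1 − w)^s` is complex-differentiable on `{Re w < 1}` (`1 − w` stays in the slit plane).
[folklore] -/
theorem differentiableOn_one_sub_cpow (s : ℂ) :
    DifferentiableOn ℂ (fun w : ℂ => (1 - w) ^ s) {w : ℂ | w.re < 1} := fun _ hw =>
  (((differentiableAt_const (1 : ℂ)).sub differentiableAt_id).cpow (differentiableAt_const s)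
    (Complex.mem_slitPlane_iff.2 (Or.inl (re_one_sub_pos hw)))).differentiableWithinAt

/-- **Euler's transformation** (DLMF 15.8.1, third form) for Euler's hypergeometric function on
the half-plane `Re z < 1`, for `0 < Re b < Re c` (so that both Euler integrals converge):
`E(a,b;c;z) = (1 − z)^{c−a−b} E(c−a, c−b; c; z)`. Both sides are analytic on the convex
half-plane and agree on the unit disc (`ordinaryHypergeometric_euler` + DLMF 15.6.1); identity
theorem. [cite: DLMF, 15.8.1] -/
theorem eulerHypergeometric_euler (a : ℂ) {b c : ℂ} (hb : 0 < b.re) (hbc : b.re < c.re) {z : ℂ}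
    (hz : z.re < 1) :
    eulerHypergeometric a b c z = (1 - z) ^ (c - a - b) * eulerHypergeometric (c - a) (c - b) c z := by
  have hc : 0 < c.re := hb.trans hbc
  have hcb : 0 < (c - b).re := by rw [Complex.sub_re]; linarith
  have hcbc : (c - b).re < c.re := by rw [Complex.sub_re]; linarith
  have hF : AnalyticOnNhd ℂ (eulerHypergeometric a b c) {w : ℂ | w.re < 1} :=
    analyticOnNhd_eulerHypergeometric a hb hbc
  have hG : AnalyticOnNhd ℂ (fun w => (1 - w) ^ (c - a - b) * eulerHypergeometric (c - a) (c - b) c w)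
      {w : ℂ | w.re < 1} :=
    ((differentiableOn_one_sub_cpow (c - a - b)).mul
      (differentiableOn_eulerHypergeometric (c - a) hcb hcbc)).analyticOnNhd isOpen_re_lt_one
  have hev : eulerHypergeometric a b c =ᶠ[𝓝 (0 : ℂ)]
      fun w => (1 - w) ^ (c - a - b) * eulerHypergeometric (c - a) (c - b) c w := by
    refine Filter.eventually_of_mem (ball_mem_nhds (0 : ℂ) one_pos) fun w hw => ?_
    have hw' : ‖w‖ < 1 := mem_ball_zero_iff.1 hw
    show eulerHypergeometric a b c w = (1 - w) ^ (c - a - b) * eulerHypergeometric (c - a) (c - b) c w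
    rw [eulerHypergeometric_eq_ordinaryHypergeometric a hb hbc hw',
      eulerHypergeometric_eq_ordinaryHypergeometric (c - a) hcb hcbc hw',
      ordinaryHypergeometric_euler (ne_neg_nat_of_re_pos' hc) hw']
  have h0 : (0 : ℂ) ∈ {w : ℂ | w.re < 1} := by
    show (0 : ℂ).re < 1
    simp
  exact hF.eqOn_of_preconnected_of_eventuallyEq hG convex_re_lt_one.isPreconnected h0 hev hz

/-- **Euler's transformation in the throat variable `z = −x`**: for `0 < Re b < Re c` and real
`x > −1`, `E(a,b;c;−x) = (1 + x)^{c−a−b} E(c−a, c−b; c; −x)`. [cite: DLMF, 15.8.1] -/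
theorem eulerHypergeometric_neg_ofReal_euler (a : ℂ) {b c : ℂ} (hb : 0 < b.re)
    (hbc : b.re < c.re) {x : ℝ} (hx : -1 < x) :
    eulerHypergeometric a b c (-(x : ℂ)) =
      (1 + (x : ℂ)) ^ (c - a - b) * eulerHypergeometric (c - a) (c - b) c (-(x : ℂ)) := by
  have hz : (-(x : ℂ)).re < 1 := by simp; linarith
  rw [eulerHypergeometric_euler a hb hbc hz, sub_neg_eq_add]

/-! ### The symmetry `a ↔ b` where both Euler integrals converge -/

/-- **Symmetry in the numerator parameters** for Euler's integral: when BOTH `0 < Re a < Re c`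
and `0 < Re b < Re c`, `E(a,b;c;z) = E(b,a;c;z)` on `Re z < 1` — two different integrals, both
equal to the (symmetric) series on the disc; identity theorem on the convex half-plane.
[cite: DLMF, 15.6.1] -/
theorem eulerHypergeometric_symm {a b c : ℂ} (ha : 0 < a.re) (hac : a.re < c.re) (hb : 0 < b.re)
    (hbc : b.re < c.re) {z : ℂ} (hz : z.re < 1) :
    eulerHypergeometric a b c z = eulerHypergeometric b a c z := by
  have hev : eulerHypergeometric a b c =ᶠ[𝓝 (0 : ℂ)] eulerHypergeometric b a c := by
    refine Filter.eventually_of_mem (ball_mem_nhds (0 : ℂ) one_pos) fun w hw => ?_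
    have hw' : ‖w‖ < 1 := mem_ball_zero_iff.1 hw
    rw [eulerHypergeometric_eq_ordinaryHypergeometric a hb hbc hw',
      eulerHypergeometric_eq_ordinaryHypergeometric b ha hac hw']
    unfold ordinaryHypergeometric
    rw [ordinaryHypergeometricSeries_symm]
  have h0 : (0 : ℂ) ∈ {w : ℂ | w.re < 1} := by
    show (0 : ℂ).re < 1
    simp
  exact (analyticOnNhd_eulerHypergeometric a hb hbc).eqOn_of_preconnected_of_eventuallyEq
    (analyticOnNhd_eulerHypergeometric b ha hac) convex_re_lt_one.isPreconnected h0 hev hz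

/-! ### Pfaff's second form -/

/-- **Pfaff's transformation, second form** (DLMF 15.8.1): for `0 < Re b < Re c` and `Re z < 1`,
`E(a,b;c;z) = (1 − z)^{−b} E(c−a, b; c; z/(z−1))` (Euler's transformation followed by the first
Pfaff form for `E(c−a, c−b; c; ·)`, and `(1−z)^{c−a−b}(1−z)^{a−c} = (1−z)^{−b}`).
[cite: DLMF, 15.8.1] -/
theorem eulerHypergeometric_pfaff' (a : ℂ) {b c : ℂ} (hb : 0 < b.re) (hbc : b.re < c.re) {z : ℂ}
    (hz : z.re < 1) :
    eulerHypergeometric a b c z = (1 - z) ^ (-b) * eulerHypergeometric (c - a) b c (z / (z - 1)) := by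
  have h1z : (1 : ℂ) - z ≠ 0 := sub_ne_zero.2 (ne_one_of_re_lt_one hz).symm
  rw [eulerHypergeometric_euler a hb hbc hz, eulerHypergeometric_pfaff (c - a) (c - b) c hz,
    show c - (c - b) = b by ring, ← mul_assoc, ← Complex.cpow_add _ _ h1z,
    show c - a - b + -(c - a) = -b by ring]

/-- **Pfaff's second form for Gauss's series** on the lens `‖z‖ < 1, Re z < ½`, for
`Re c > Re b > 0`: `₂F₁(a,b;c;z) = (1 − z)^{−b} ₂F₁(c−a, b; c; z/(z−1))`. [cite: DLMF, 15.8.1] -/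
theorem ordinaryHypergeometric_pfaff' (a : ℂ) {b c : ℂ} (hb : 0 < b.re) (hbc : b.re < c.re)
    {z : ℂ} (hz : ‖z‖ < 1) (hz' : z.re < 1 / 2) :
    ₂F₁ a b c z = (1 - z) ^ (-b) * ₂F₁ (c - a) b c (z / (z - 1)) := by
  have hre : z.re < 1 := by linarith
  rw [← eulerHypergeometric_eq_ordinaryHypergeometric a hb hbc hz,
    ← eulerHypergeometric_eq_ordinaryHypergeometric (c - a) hb hbc (norm_div_sub_one_lt_one hz'),
    eulerHypergeometric_pfaff' a hb hbc hre]

/-- The throat form of Pfaff's second transformation: for `0 < Re b < Re c` and real `x > −1`,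
`E(a,b;c;−x) = (1 + x)^{−b} E(c−a, b; c; x/(1+x))`. [cite: DLMF, 15.8.1] -/
theorem eulerHypergeometric_neg_ofReal_pfaff' (a : ℂ) {b c : ℂ} (hb : 0 < b.re)
    (hbc : b.re < c.re) {x : ℝ} (hx : -1 < x) :
    eulerHypergeometric a b c (-(x : ℂ)) =
      (1 + (x : ℂ)) ^ (-b) * eulerHypergeometric (c - a) b c ((x : ℂ) / (1 + x)) := by
  have hz : (-(x : ℂ)).re < 1 := by simp; linarith
  rw [eulerHypergeometric_pfaff' a hb hbc hz, sub_neg_eq_add,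
    show -(x : ℂ) - 1 = -(1 + (x : ℂ)) by ring, neg_div_neg_eq]

end Literature.Analysis.SpecialFunctions.Hypergeometric

end
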